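import Summits.AtomisticToContinuum.FouriersLaw.Theorems.PhononMeanFreePathIncoherentBoundedCoherentLandauer

/-!
# `IncoherentChannel`, line `two-horizons-forecast-loss` — the `N`-uniform FORECAST BUDGET: coherent channel + echo

Helper file for the lead's stub `stub_forecastLoss` (the ENGINE) of crux `PhononMeanFreePath.IncoherentChannel`
(item stmt-AtomisticToContinuum-11811, route `PhononMeanFreePath`, sub-problem `FouriersLaw`). For the `(N+1)`-site
pinned anharmonic chain `pinnedChain ω₂ lam β γ` with both baths at `T` (`μ₀ = gibbsMeasure (N+1) T`,
`K_t = transitionKernel (N+1) T T t⁺`, the CONSTRUCTED objects) write `u_t = K_t p_N` (the mean forecast of the bath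
momentum, `fcast`), `S_N(t) = ‖u_t‖²_{L²(μ₀)}` (`fnorm`), `r_N(t) = ∫ p_0 u_t dμ₀` (the route's coherent channel,
`pairCorr`) and `a_N(t) = ∫ p_N u_t dμ₀` (the end-momentum autocorrelation, the "echo" of Disproof §6.5). The
engine asks for an `N`-uniform integrable decay of `S_N`; since `r_N² ≤ T S_N` and `a_N² ≤ T S_N` it implies
`N`-uniform envelopes for both. This file proves the corresponding UNCONDITIONAL, `N`-UNIFORM budget:

  `∫_{t>0} (r_N(t)² + a_N(t)²) dt ≤ T²/(2γ)`   for every `N`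

(`forecastBudget_lintegral_le`, lower integral; `forecastBudget_integral_le`, Bochner; registered closed form
`forecastBudget`). Mechanism: the dissipation inequality of the equilibrium semigroup (Bakry–Émery, file
`…IncoherentBoundedDissipation`) bounds `2γT ∫_{s>0} (‖∂_{p_0}u_s‖² + ‖∂_{p_N}u_s‖²) ds ≤ ‖F‖²` for `F ∈ C_c` — BOTH
bath terms of the carré du champ are kept (`sum_bathWeight_mul_eq`), where `…CoherentLandauer` kept only the
left one — and Gaussian integration by parts in `p_0`, `p_N` gives `r² ≤ T²‖∂_{p_0}u‖²`, `a² ≤ T²‖∂_{p_N}u‖²`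
(`ofReal_sq_integral_snd_mul_forecast_le`); truncation `χ_k p_N → p_N`, dominated convergence and Fatou conclude.
So the forecast budget `T` of the bath momentum pays for the coherent channel AND the echo jointly, uniformly in
`N`; the engine is the (open) statement that it is spent at an `N`-uniform RATE. No definitions; nothing here
closes an item.
-/

noncomputable section

namespace Summit.AtomisticToContinuum.FouriersLaw.Theorems.PhononMeanFreePath

open MeasureTheory ProbabilityTheory Set Filter Topology
open scoped NNReal ENNReal ContDiff
open Literature.MathematicalPhysics.KineticTheory.HeatConduction
open Literature.MathematicalPhysics.KineticTheory Literature.Probability.Process OscillatorChain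
open Summit.AtomisticToContinuum.FouriersLaw.Theorems.IncoherentBounded
open Summit.AtomisticToContinuum.FouriersLaw.Theorems.SubdiffusiveBondHeat

/-! ### Both bath terms of the carré du champ -/

/-- The bath-weighted sum of the squared momentum gradients COLLAPSES to the two bath sites:
`∑_i ([i=0]T + [i=N]T)·g_i = T·g_0 + T·g_N` on the `(N+1)`-site chain (on the one-site chain both terms sit on
site `0`). [folklore] -/
theorem sum_bathWeight_mul_eq (N : ℕ) (T : ℝ) (g : Fin (N + 1) → ℝ) :
    ∑ i : Fin (N + 1), ((if i.val = 0 then T else 0) + (if i.val = N + 1 - 1 then T else 0)) * g i =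
      T * g 0 + T * g (Fin.last N) := by
  have h1 : ∑ i : Fin (N + 1), (if i.val = 0 then T else 0) * g i = T * g 0 := by
    rw [Finset.sum_eq_single (0 : Fin (N + 1))]
    · simp
    · intro i _ hi
      have : i.val ≠ 0 := fun h => hi (Fin.ext h)
      simp [this]
    · intro h; exact absurd (Finset.mem_univ _) h
  have h2 : ∑ i : Fin (N + 1), (if i.val = N + 1 - 1 then T else 0) * g i = T * g (Fin.last N) := by
    rw [Finset.sum_eq_single (Fin.last N)]
    · simp
    · intro i _ hi
      have : i.val ≠ N := fun h => hi (Fin.ext (by simp [h]))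
      simp [this]
    · intro h; exact absurd (Finset.mem_univ _) h
  simp_rw [add_mul]
  rw [Finset.sum_add_distrib, h1, h2]

/-! ### The budget for a compactly supported observable -/

section Smooth

variable {ω₂ lam β γ : ℝ} (hω : 0 < ω₂) (hl : 0 ≤ lam) (hβ : 0 < β) (hγ : 0 < γ) {T : ℝ} (hT : 0 < T) (N : ℕ)
include hω hl hβ hγ hT

/-- **The two-sided integrated coherent bound for `F ∈ C_c(Ω)`** on the `(N+1)`-site chain:

  `∫_{s>0} [(∫ p_0 K_s F dμ_T)² + (∫ p_N K_s F dμ_T)²] ds ≤ (T/(2γ)) ∫ F² dμ_T`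

(lower Lebesgue integral on the left): both bath terms of the dissipation inequality `dissipation_lintegral_le'` and
the pointwise coherent bounds `(∫ p_j K_s F dμ_T)² ≤ T² ∫ (∂_{p_j} K_s F)² dμ_T` at `j = 0` and `j = N`. [folklore] -/
theorem forecastBudget_lintegral_smooth_le {F : PhaseSpace (N + 1) → ℝ} (hFc : Continuous F)
    (hFs : HasCompactSupport F) :
    ∫⁻ s in Ioi (0 : ℝ), (ENNReal.ofReal ((∫ x, x.2 0 *
        (∫ y, F y ∂((pinnedChain ω₂ lam β γ).transitionKernel (N + 1) T T s.toNNReal x))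
          ∂((pinnedChain ω₂ lam β γ).gibbsMeasure (N + 1) T)) ^ 2) +
      ENNReal.ofReal ((∫ x, x.2 (Fin.last N) *
        (∫ y, F y ∂((pinnedChain ω₂ lam β γ).transitionKernel (N + 1) T T s.toNNReal x))
          ∂((pinnedChain ω₂ lam β γ).gibbsMeasure (N + 1) T)) ^ 2)) ≤
      ENNReal.ofReal (T / (2 * γ) * ∫ x, F x ^ 2 ∂((pinnedChain ω₂ lam β γ).gibbsMeasure (N + 1) T)) := by
  have hNp : 0 < N + 1 := Nat.succ_pos N
  set P := pinnedChain ω₂ lam β γ with hP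
  set μ := P.gibbsMeasure (N + 1) T with hμ
  set U : ℝ → PhaseSpace (N + 1) → ℝ := fun s z => ∫ y, F y ∂(P.transitionKernel (N + 1) T T s.toNNReal z) with hU
  -- the dissipation inequality with BOTH bath terms
  have hD := dissipation_lintegral_le' hω hl hβ hγ hNp hT hFc hFs
  -- the pointwise comparison for `s > 0`
  have hstep : ∀ s : ℝ, 0 < s →
      ENNReal.ofReal ((∫ x, x.2 0 * U s x ∂μ) ^ 2) + ENNReal.ofReal ((∫ x, x.2 (Fin.last N) * U s x ∂μ) ^ 2) ≤
        ENNReal.ofReal (T / (2 * γ)) * ∫⁻ x, ENNReal.ofReal (2 * (γ * ∑ i : Fin (N + 1),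
          ((if i.val = 0 then T else 0) + (if i.val = N + 1 - 1 then T else 0)) * partialP i (U s) x ^ 2)) ∂μ := by
    intro s hs
    have hu2 : ContDiff ℝ 2 (U s) := contDiff_forecast hω hl hγ hNp hβ.le hT hT.le hFc hFs hs
    have hm : ∀ j : Fin (N + 1), Measurable fun x => ENNReal.ofReal (partialP j (U s) x ^ 2) := fun j =>
      ((continuous_partialP hu2 two_ne_zero j).measurable.pow_const 2).ennreal_ofReal
    have h0 := ofReal_sq_integral_snd_mul_forecast_le hω hl hβ hγ hT hNp (0 : Fin (N + 1)) hFc hFs hs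
    have h1 := ofReal_sq_integral_snd_mul_forecast_le hω hl hβ hγ hT hNp (Fin.last N) hFc hFs hs
    -- both gradients under ONE integral
    have hsum : (∫⁻ x, ENNReal.ofReal (partialP 0 (U s) x ^ 2) ∂μ) +
        ∫⁻ x, ENNReal.ofReal (partialP (Fin.last N) (U s) x ^ 2) ∂μ =
        ∫⁻ x, (ENNReal.ofReal (partialP 0 (U s) x ^ 2) + ENNReal.ofReal (partialP (Fin.last N) (U s) x ^ 2)) ∂μ :=
      (lintegral_add_left (hm 0) _).symm
    have hpt : ∀ x, ENNReal.ofReal (2 * γ * T) * (ENNReal.ofReal (partialP 0 (U s) x ^ 2) +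
        ENNReal.ofReal (partialP (Fin.last N) (U s) x ^ 2)) ≤
        ENNReal.ofReal (2 * (γ * ∑ i : Fin (N + 1),
          ((if i.val = 0 then T else 0) + (if i.val = N + 1 - 1 then T else 0)) * partialP i (U s) x ^ 2)) := by
      intro x
      rw [← ENNReal.ofReal_add (sq_nonneg _) (sq_nonneg _), ← ENNReal.ofReal_mul (by positivity)]
      refine ENNReal.ofReal_le_ofReal (le_of_eq ?_)
      rw [sum_bathWeight_mul_eq N T (fun i => partialP i (U s) x ^ 2)]
      ring
    have hcmp : ENNReal.ofReal (2 * γ * T) * ((∫⁻ x, ENNReal.ofReal (partialP 0 (U s) x ^ 2) ∂μ) +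
        ∫⁻ x, ENNReal.ofReal (partialP (Fin.last N) (U s) x ^ 2) ∂μ) ≤
        ∫⁻ x, ENNReal.ofReal (2 * (γ * ∑ i : Fin (N + 1),
          ((if i.val = 0 then T else 0) + (if i.val = N + 1 - 1 then T else 0)) * partialP i (U s) x ^ 2)) ∂μ := by
      rw [hsum, ← lintegral_const_mul' _ _ ENNReal.ofReal_ne_top]
      exact lintegral_mono hpt
    have hTfac : ENNReal.ofReal (T ^ 2) = ENNReal.ofReal (T / (2 * γ)) * ENNReal.ofReal (2 * γ * T) := by
      rw [← ENNReal.ofReal_mul (by positivity)]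
      congr 1
      field_simp
    calc ENNReal.ofReal ((∫ x, x.2 0 * U s x ∂μ) ^ 2) + ENNReal.ofReal ((∫ x, x.2 (Fin.last N) * U s x ∂μ) ^ 2)
        ≤ ENNReal.ofReal (T ^ 2) * (∫⁻ x, ENNReal.ofReal (partialP 0 (U s) x ^ 2) ∂μ) +
          ENNReal.ofReal (T ^ 2) * ∫⁻ x, ENNReal.ofReal (partialP (Fin.last N) (U s) x ^ 2) ∂μ := add_le_add h0 h1
      _ = ENNReal.ofReal (T / (2 * γ)) * (ENNReal.ofReal (2 * γ * T) *
          ((∫⁻ x, ENNReal.ofReal (partialP 0 (U s) x ^ 2) ∂μ) +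
            ∫⁻ x, ENNReal.ofReal (partialP (Fin.last N) (U s) x ^ 2) ∂μ)) := by
          rw [← mul_add, hTfac, mul_assoc]
      _ ≤ _ := by gcongr
  -- integrate over `s > 0`
  calc ∫⁻ s in Ioi (0 : ℝ), (ENNReal.ofReal ((∫ x, x.2 0 * U s x ∂μ) ^ 2) +
        ENNReal.ofReal ((∫ x, x.2 (Fin.last N) * U s x ∂μ) ^ 2))
      ≤ ∫⁻ s in Ioi (0 : ℝ), ENNReal.ofReal (T / (2 * γ)) * ∫⁻ x, ENNReal.ofReal (2 * (γ * ∑ i : Fin (N + 1),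
          ((if i.val = 0 then T else 0) + (if i.val = N + 1 - 1 then T else 0)) * partialP i (U s) x ^ 2)) ∂μ :=
        setLIntegral_mono' measurableSet_Ioi fun s hs => hstep s hs
    _ = ENNReal.ofReal (T / (2 * γ)) * ∫⁻ s in Ioi (0 : ℝ), ∫⁻ x, ENNReal.ofReal (2 * (γ * ∑ i : Fin (N + 1),
          ((if i.val = 0 then T else 0) + (if i.val = N + 1 - 1 then T else 0)) * partialP i (U s) x ^ 2)) ∂μ :=
        lintegral_const_mul' _ _ ENNReal.ofReal_ne_top
    _ ≤ ENNReal.ofReal (T / (2 * γ)) * ENNReal.ofReal (∫ x, F x ^ 2 ∂μ) := by gcongr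
    _ = ENNReal.ofReal (T / (2 * γ) * ∫ x, F x ^ 2 ∂μ) := by rw [← ENNReal.ofReal_mul (by positivity)]

end Smooth

/-! ### The budget for the bath momentum: truncation, dominated convergence, Fatou -/

section Item

variable {ω₂ lam β γ : ℝ} (hω : 0 < ω₂) (hl : 0 ≤ lam) (hβ : 0 < β) (hγ : 0 < γ) {T : ℝ} (hT : 0 < T)
include hω hl hβ hγ hT

/-- **The `N`-uniform forecast budget, lower-integral form.** For every `N`,

  `∫_{t>0} (r_N(t)² + a_N(t)²) dt ≤ T²/(2γ)`,  `r_N(t) = ∫ p_0 (K_t p_N) dμ₀`, `a_N(t) = ∫ p_N (K_t p_N) dμ₀`: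

truncate `p_N` to `F_k = χ_k p_N ∈ C_c` (`∫ F_k² dμ₀ ≤ ∫ p_N² dμ₀ = T`), apply `forecastBudget_lintegral_smooth_le`,
pass to the limit inside both correlations by dominated convergence (twice) and conclude by Fatou in `t`. [folklore] -/
theorem forecastBudget_lintegral_le (N : ℕ) :
    ∫⁻ t in Ioi (0 : ℝ), (ENNReal.ofReal ((∫ z, z.2 0 *
        (∫ y, y.2 (Fin.last N) ∂((pinnedChain ω₂ lam β γ).transitionKernel (N + 1) T T t.toNNReal z))
          ∂((pinnedChain ω₂ lam β γ).gibbsMeasure (N + 1) T)) ^ 2) +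
      ENNReal.ofReal ((∫ z, z.2 (Fin.last N) *
        (∫ y, y.2 (Fin.last N) ∂((pinnedChain ω₂ lam β γ).transitionKernel (N + 1) T T t.toNNReal z))
          ∂((pinnedChain ω₂ lam β γ).gibbsMeasure (N + 1) T)) ^ 2)) ≤
      ENNReal.ofReal (T ^ 2 / (2 * γ)) := by
  set P := pinnedChain ω₂ lam β γ with hP
  set μ := P.gibbsMeasure (N + 1) T with hμ
  haveI : IsProbabilityMeasure μ := pinnedChain_isProbabilityMeasure_gibbsMeasure hω hl hβ.le γ (N + 1) hT
  haveI hMK : ∀ t, IsMarkovKernel (P.transitionKernel (N + 1) T T t) := fun t =>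
    pinnedChain_isMarkovKernel_transitionKernel hω hl hβ.le hγ.le (N + 1) T T t
  have hNp : 0 < N + 1 := Nat.succ_pos N
  -- the truncations `F_k = χ_k · p_N`
  set pL : PhaseSpace (N + 1) → ℝ := fun y => y.2 (Fin.last N) with hpL
  have hpLc : Continuous pL := by fun_prop
  set χ : ℕ → ContDiffBump (0 : PhaseSpace (N + 1)) := fun k =>
    ⟨(k : ℝ) + 1, (k : ℝ) + 2, by positivity, by linarith⟩ with hχ
  set Fk : ℕ → PhaseSpace (N + 1) → ℝ := fun k y => (χ k) y * pL y with hFk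
  have hFkc : ∀ k, Continuous (Fk k) := fun k => (χ k).continuous.mul hpLc
  have hFks : ∀ k, HasCompactSupport (Fk k) := fun k => (χ k).hasCompactSupport.mul_right
  have hFk_le : ∀ k y, |Fk k y| ≤ |pL y| := fun k y => by
    rw [hFk]; dsimp only; rw [abs_mul, abs_of_nonneg (χ k).nonneg]
    exact mul_le_of_le_one_left (abs_nonneg _) (χ k).le_one
  have hFk_lim : ∀ y, Tendsto (fun k => Fk k y) atTop (𝓝 (pL y)) := by
    intro y
    refine tendsto_const_nhds.congr' ?_
    obtain ⟨k₀, hk₀⟩ := exists_nat_ge ‖y‖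
    filter_upwards [eventually_ge_atTop k₀] with k hk
    rw [hFk]; dsimp only
    rw [(χ k).one_of_mem_closedBall, one_mul]
    rw [Metric.mem_closedBall, dist_zero_right]
    calc ‖y‖ ≤ k₀ := hk₀
      _ ≤ k := by exact_mod_cast hk
      _ ≤ (k : ℝ) + 1 := by linarith
  -- `L²(μ₀)`-norms of the truncations: `∫ F_k² dμ₀ ≤ ∫ p_N² dμ₀ = T`
  have hϑ0 : (0 : ℝ) < 1 / (4 * T) := by positivity
  have hϑ1 : 1 / (4 * T) < 1 / T := by
    rw [div_lt_div_iff₀ (by positivity) hT]; nlinarith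
  have hexpμ := pinnedChain_integrable_exp_mul_hamiltonian_gibbsMeasure hω hl hβ.le γ (N + 1) hT hϑ1
  have hpL2 : Integrable (fun y => pL y ^ 2) μ :=
    integrable_of_abs_le_exp hexpμ (by fun_prop) (fun y => by
      rw [abs_of_nonneg (sq_nonneg _)]
      exact sq_momentum_le_exp (γ := γ) hω hl hβ.le hϑ0 y (Fin.last N))
  have hFk2 : ∀ k, ∫ y, Fk k y ^ 2 ∂μ ≤ T := by
    intro k
    rw [← integral_momentum_sq_gibbsMeasure (γ := γ) hω hl hβ hT (N + 1) (Fin.last N)]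
    refine integral_mono_of_nonneg (ae_of_all _ fun y => sq_nonneg _) hpL2 (ae_of_all _ fun y => ?_)
    show Fk k y ^ 2 ≤ y.2 (Fin.last N) ^ 2
    exact (sq_le_sq' (abs_le.1 (hFk_le k y)).1 (abs_le.1 (hFk_le k y)).2).trans (le_of_eq (sq_abs _))
  -- the approximating correlations with weight `p_j` (`j = 0`: coherent channel; `j = N`: echo) and their limits
  set ck : Fin (N + 1) → ℕ → ℝ → ℝ := fun j k t => ∫ z, z.2 j *
    (∫ y, Fk k y ∂(P.transitionKernel (N + 1) T T t.toNNReal z)) ∂μ with hck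
  set c : Fin (N + 1) → ℝ → ℝ := fun j t => ∫ z, z.2 j *
    (∫ y, pL y ∂(P.transitionKernel (N + 1) T T t.toNNReal z)) ∂μ with hc
  have hck_bound : ∀ k, ∫⁻ t in Ioi (0 : ℝ), (ENNReal.ofReal (ck 0 k t ^ 2) +
      ENNReal.ofReal (ck (Fin.last N) k t ^ 2)) ≤ ENNReal.ofReal (T ^ 2 / (2 * γ)) := by
    intro k
    refine (forecastBudget_lintegral_smooth_le hω hl hβ hγ hT N (hFkc k) (hFks k)).trans ?_
    refine ENNReal.ofReal_le_ofReal ?_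
    calc T / (2 * γ) * ∫ x, Fk k x ^ 2 ∂μ ≤ T / (2 * γ) * T :=
          mul_le_mul_of_nonneg_left (hFk2 k) (by positivity)
      _ = T ^ 2 / (2 * γ) := by ring
  have hck_meas : ∀ j k, Measurable (ck j k) := fun j k =>
    measurable_corr hω hl hβ hγ hT (f := fun z : PhaseSpace (N + 1) => z.2 j) (by fun_prop) (hFkc k)
  -- dominated convergence inside the kernels
  have hin : ∀ (t : ℝ) (z : PhaseSpace (N + 1)),
      Tendsto (fun k => ∫ y, Fk k y ∂(P.transitionKernel (N + 1) T T t.toNNReal z)) atTop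
        (𝓝 (∫ y, pL y ∂(P.transitionKernel (N + 1) T T t.toNNReal z))) := by
    intro t z
    have hexpK := pinnedChain_integrable_exp_mul_hamiltonian_transitionKernel hω hl hT hβ.le hγ.le hNp hϑ0 hϑ1
      t.toNNReal z
    have hbd : Integrable (fun y => |pL y|) (P.transitionKernel (N + 1) T T t.toNNReal z) :=
      integrable_of_abs_le_exp hexpK (by fun_prop) (fun y => by
        rw [abs_abs]; exact abs_momentum_le_exp hω hl hβ.le hϑ0 y (Fin.last N))
    refine tendsto_integral_of_dominated_convergence (fun y => |pL y|)
      (fun k => (hFkc k).aestronglyMeasurable) hbd (fun k => ae_of_all _ fun y => ?_)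
      (ae_of_all _ fun y => hFk_lim y)
    rw [Real.norm_eq_abs]; exact hFk_le k y
  -- dominated convergence under `μ₀`, for either weight
  have hout : ∀ (j : Fin (N + 1)) (t : ℝ), Tendsto (fun k => ck j k t) atTop (𝓝 (c j t)) := by
    intro j t
    have hdom : Integrable (fun z : PhaseSpace (N + 1) => |z.2 j| *
        ∫ y, |pL y| ∂(P.transitionKernel (N + 1) T T t.toNNReal z)) μ :=
      integrable_mul_act hω hl hβ hγ hT (f := fun z : PhaseSpace (N + 1) => |z.2 j|) (g := fun y => |pL y|)
        (by fun_prop) (by fun_prop)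
        (fun y => by rw [abs_abs]; exact abs_momentum_le_exp hω hl hβ.le hϑ0 y j)
        (fun y => by rw [abs_abs]; exact abs_momentum_le_exp hω hl hβ.le hϑ0 y (Fin.last N)) t.toNNReal
    refine tendsto_integral_of_dominated_convergence
      (fun z : PhaseSpace (N + 1) => |z.2 j| * ∫ y, |pL y| ∂(P.transitionKernel (N + 1) T T t.toNNReal z))
      (fun k => ?_) hdom (fun k => ae_of_all _ fun z => ?_) (ae_of_all _ fun z => (hin t z).const_mul (z.2 j))
    · exact (Continuous.aestronglyMeasurable (by fun_prop)).mul
        ((hFkc k).stronglyMeasurable.integral_kernel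
          (κ := P.transitionKernel (N + 1) T T t.toNNReal)).aestronglyMeasurable
    · rw [Real.norm_eq_abs, abs_mul]
      refine mul_le_mul_of_nonneg_left ?_ (abs_nonneg _)
      have hexpK := pinnedChain_integrable_exp_mul_hamiltonian_transitionKernel hω hl hT hβ.le hγ.le hNp hϑ0 hϑ1
        t.toNNReal z
      have hbd : Integrable (fun y => |pL y|) (P.transitionKernel (N + 1) T T t.toNNReal z) :=
        integrable_of_abs_le_exp hexpK (by fun_prop) (fun y => by
          rw [abs_abs]; exact abs_momentum_le_exp hω hl hβ.le hϑ0 y (Fin.last N))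
      calc |∫ y, Fk k y ∂(P.transitionKernel (N + 1) T T t.toNNReal z)|
          ≤ ∫ y, |Fk k y| ∂(P.transitionKernel (N + 1) T T t.toNNReal z) := abs_integral_le_integral_abs
        _ ≤ ∫ y, |pL y| ∂(P.transitionKernel (N + 1) T T t.toNNReal z) :=
          integral_mono_of_nonneg (ae_of_all _ fun y => abs_nonneg _) hbd (ae_of_all _ fun y => hFk_le k y)
  -- Fatou in `t`, on the sum of the two squared correlations
  have hlim : ∀ t, liminf (fun k => ENNReal.ofReal (ck 0 k t ^ 2) + ENNReal.ofReal (ck (Fin.last N) k t ^ 2)) atTop =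
      ENNReal.ofReal (c 0 t ^ 2) + ENNReal.ofReal (c (Fin.last N) t ^ 2) := fun t =>
    ((ENNReal.tendsto_ofReal ((hout 0 t).pow 2)).add (ENNReal.tendsto_ofReal ((hout (Fin.last N) t).pow 2))).liminf_eq
  calc ∫⁻ t in Ioi (0 : ℝ), (ENNReal.ofReal (c 0 t ^ 2) + ENNReal.ofReal (c (Fin.last N) t ^ 2))
      = ∫⁻ t in Ioi (0 : ℝ), liminf (fun k => ENNReal.ofReal (ck 0 k t ^ 2) +
          ENNReal.ofReal (ck (Fin.last N) k t ^ 2)) atTop :=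
        lintegral_congr fun t => (hlim t).symm
    _ ≤ liminf (fun k => ∫⁻ t in Ioi (0 : ℝ), (ENNReal.ofReal (ck 0 k t ^ 2) +
          ENNReal.ofReal (ck (Fin.last N) k t ^ 2))) atTop :=
        lintegral_liminf_le fun k => (((hck_meas 0 k).pow_const 2).ennreal_ofReal).add
          (((hck_meas (Fin.last N) k).pow_const 2).ennreal_ofReal)
    _ ≤ ENNReal.ofReal (T ^ 2 / (2 * γ)) :=
        liminf_le_of_frequently_le' (Frequently.of_forall fun k => hck_bound k)

/-- **Exponential decay of the end-momentum autocorrelation at fixed size**: `|a_N(t)| ≤ C_N e^{-c_N t}` for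
`t ≥ 0` (`c_N > 0`), `a_N(t) = ∫ p_N (K_t p_N) dμ₀`, since `∫ p_N dμ₀ = 0`.
[cite: CuneoEckmannHairerReyBellet2018, Thm 2.13 (3)] -/
theorem aN_exp_decay (N : ℕ) :
    ∃ C c : ℝ, 0 < c ∧ ∀ t : ℝ, 0 ≤ t →
      |∫ z, z.2 (Fin.last N) * (∫ y, y.2 (Fin.last N)
        ∂((pinnedChain ω₂ lam β γ).transitionKernel (N + 1) T T t.toNNReal z))
        ∂((pinnedChain ω₂ lam β γ).gibbsMeasure (N + 1) T)| ≤ C * Real.exp (-c * t) := by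
  have hϑ0 : (0 : ℝ) < 1 / (4 * T) := by positivity
  obtain ⟨C, c, hc, hb⟩ := corr_sub_exp_decay hω hl hβ hγ (Nat.succ_pos N) hT
    (f := fun z : PhaseSpace (N + 1) => z.2 (Fin.last N)) (g := fun z : PhaseSpace (N + 1) => z.2 (Fin.last N))
    (by fun_prop) (by fun_prop) (fun y => abs_momentum_le_exp hω hl hβ.le hϑ0 y (Fin.last N))
    (fun y => abs_momentum_le_exp hω hl hβ.le hϑ0 y (Fin.last N))
  refine ⟨C, c, hc, fun t ht => ?_⟩
  have h := hb t.toNNReal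
  rwa [integral_momentum_gibbsMeasure, zero_mul, sub_zero, Real.coe_toNNReal _ ht] at h

/-- `t ↦ a_N(t)` is measurable. [folklore] -/
theorem measurable_aN (N : ℕ) :
    Measurable fun t : ℝ => ∫ z, z.2 (Fin.last N) *
        (∫ y, y.2 (Fin.last N) ∂((pinnedChain ω₂ lam β γ).transitionKernel (N + 1) T T t.toNNReal z))
      ∂((pinnedChain ω₂ lam β γ).gibbsMeasure (N + 1) T) :=
  measurable_corr hω hl hβ hγ hT (by fun_prop) (by fun_prop)

/-- `t ↦ a_N(t)²` is integrable on `(0, ∞)` at every fixed `N` (`a_N² ≤ C_N² e^{-2c_N t}`).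
[cite: CuneoEckmannHairerReyBellet2018, Thm 2.13 (3)] -/
theorem aN_sq_integrableOn (N : ℕ) :
    IntegrableOn (fun t : ℝ => (∫ z, z.2 (Fin.last N) *
        (∫ y, y.2 (Fin.last N) ∂((pinnedChain ω₂ lam β γ).transitionKernel (N + 1) T T t.toNNReal z))
      ∂((pinnedChain ω₂ lam β γ).gibbsMeasure (N + 1) T)) ^ 2) (Set.Ioi 0) := by
  obtain ⟨C, c, hc, hb⟩ := aN_exp_decay hω hl hβ hγ hT N
  have hC0 : 0 ≤ C := by
    have h := (abs_nonneg _).trans (hb 0 le_rfl)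
    simpa using h
  refine Integrable.mono' ((exp_neg_integrableOn_Ioi 0 (by positivity : 0 < 2 * c)).const_mul (C ^ 2))
    ((measurable_aN hω hl hβ hγ hT N).pow_const 2).aestronglyMeasurable ?_
  refine (ae_restrict_iff' measurableSet_Ioi).2 (Eventually.of_forall fun t ht => ?_)
  rw [Real.norm_eq_abs, abs_pow, show C ^ 2 * Real.exp (-(2 * c) * t) = (C * Real.exp (-c * t)) ^ 2 by
    rw [mul_pow, ← Real.exp_nat_mul]; congr 1; push_cast; ring_nf]
  exact pow_le_pow_left₀ (abs_nonneg _) (hb t (le_of_lt ht)) 2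

/-- **The `N`-uniform forecast budget, Bochner form.** For every `N`,

  `∫_{t>0} (r_N(t)² + a_N(t)²) dt ≤ T²/(2γ)`

— the coherent channel `r_N` of the route AND the echo `a_N` of the bath momentum are jointly square-integrable in
time with an explicit `N`-uniform constant (the forecast norm budget `T` of `p_N` spent through the two baths).
[folklore] -/
theorem forecastBudget_integral_le (N : ℕ) :
    ∫ t in Ioi (0 : ℝ), ((∫ z, z.2 0 *
        (∫ y, y.2 (Fin.last N) ∂((pinnedChain ω₂ lam β γ).transitionKernel (N + 1) T T t.toNNReal z))
          ∂((pinnedChain ω₂ lam β γ).gibbsMeasure (N + 1) T)) ^ 2 +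
      (∫ z, z.2 (Fin.last N) *
        (∫ y, y.2 (Fin.last N) ∂((pinnedChain ω₂ lam β γ).transitionKernel (N + 1) T T t.toNNReal z))
          ∂((pinnedChain ω₂ lam β γ).gibbsMeasure (N + 1) T)) ^ 2) ≤ T ^ 2 / (2 * γ) := by
  have hr := rN_sq_integrableOn hω hl hβ hγ hT N
  have ha := aN_sq_integrableOn hω hl hβ hγ hT N
  have hi := hr.add ha
  rw [integral_eq_lintegral_of_nonneg_ae (ae_of_all _ fun t => add_nonneg (sq_nonneg _) (sq_nonneg _))
    hi.aestronglyMeasurable]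
  refine ENNReal.toReal_le_of_le_ofReal (by positivity) ?_
  refine le_trans (le_of_eq ?_) (forecastBudget_lintegral_le hω hl hβ hγ hT N)
  refine lintegral_congr fun t => ?_
  rw [ENNReal.ofReal_add (sq_nonneg _) (sq_nonneg _)]

end Item

/-- **THE `N`-UNIFORM FORECAST BUDGET** (registered sub-goal, closed form of `forecastBudget_integral_le`): for the
pinned anharmonic chain (`ω₂, β, γ > 0`, `lam ≥ 0`) with both baths at `T > 0` and EVERY `N`,

  `∫_{t>0} (r_N(t)² + a_N(t)²) dt ≤ T²/(2γ)`,

`r_N(t) = ∫ p_0 (K_t p_N) dμ₀` the route's coherent channel (`pairCorr`), `a_N(t) = ∫ p_N (K_t p_N) dμ₀` the echo of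
the bath momentum. The engine `stub_forecastLoss` of line `two-horizons-forecast-loss` would give `N`-uniform
pointwise envelopes `r_N², a_N² ≤ T·C(1+t)^{-α}`; this is the unconditional integrated counterpart (dissipation
inequality with both bath terms + Gaussian integration by parts + truncation). [folklore] -/
theorem forecastBudget : ∀ ω₂ lam β γ : ℝ, 0 < ω₂ → 0 ≤ lam → 0 < β → 0 < γ → ∀ T : ℝ, 0 < T → ∀ N : ℕ, ∫ t in Ioi (0 : ℝ), ((∫ z, z.2 0 * (∫ y, y.2 (Fin.last N) ∂((pinnedChain ω₂ lam β γ).transitionKernel (N + 1) T T t.toNNReal z)) ∂((pinnedChain ω₂ lam β γ).gibbsMeasure (N + 1) T)) ^ 2 + (∫ z, z.2 (Fin.last N) * (∫ y, y.2 (Fin.last N) ∂((pinnedChain ω₂ lam β γ).transitionKernel (N + 1) T T t.toNNReal z)) ∂((pinnedChain ω₂ lam β γ).gibbsMeasure (N + 1) T)) ^ 2) ≤ T ^ 2 / (2 * γ) :=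
  fun _ _ _ _ hω hl hβ hγ _ hT N => forecastBudget_integral_le hω hl hβ hγ hT N

end Summit.AtomisticToContinuum.FouriersLaw.Theorems.PhononMeanFreePath

end
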